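import Literature.Geometry.Riemannian.MetricFlowFLimitWithin
import Literature.Geometry.Riemannian.MetricFlowFLimitPair
import HarnessLib

/-!
# Bamler 2023, §5.4, Lemma 5.20 (arXiv v1 Lemma 121): the limit within a correspondence — the
# registered milestone stub `stub_limitWithin` of line `ancient-sphere-rigidity` (crux
# `EntropyRung.SubcylindricalRecognition`, stmt-SmoothPoincare4-10869), CLOSED by composition

R. Bamler, *Compactness theory of the space of super Ricci flows*, Invent. Math. 233 (2023), §5.4,
Lemma 5.20: a sequence of metric flow pairs that is Cauchy within one correspondence `ℭ` with
complete comparison spaces, uniformly over `J`, has a limit metric flow pair `(𝒳^∞, (μ^∞_t))` over `I`,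
fully defined over `J`, and `ℭ` extends to a correspondence `ℭ'` within which the sequence
`𝔽`-converges to the limit uniformly over `J`. Tree form (universe `0`, `H`-concentrated flows —
all flows of Bamler's compactness theory —, complete separable comparison spaces, and the
`H`-concentration of the limit recorded): the conjunction below.

Proof = composition of the two landed halves: the CONSTRUCTION of the limit pair along a fast chain
`MetricFlowPair.exists_limitPair_of_chain` (MetricFlowFLimitPair.lean with Aux1–5: good times,
`W₁`-limits of the pushed measures and their supports as the limit slices, the conjugate heat kernels as
`W₁`-limits via Lemma 5.17, Def. 3.2 (6) by Lemma 3.3 and the limit gradient estimate, (7) and the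
conjugate heat flow identity by the limit reproduction formula, `H`-concentration by lower
semicontinuity of the variance) and the CONVERGENCE within the extended correspondence
`MetricFlowPair.limit_fConvergesWithin_of_limitPair` (MetricFlowFLimitWithin.lean: fast sub-chain,
extension `ℭ'` over `Option ℕ`, admissibility of the pairs `(i, ∞)` by (5.29)–(5.31), back to the full
sequence by the triangle inequality within `ℭ'`). No named facts are used.

## References

* [Bamler2023] R. H. Bamler, *Compactness theory of the space of super Ricci flows*, Invent. Math. 233
  (2023), 1121–1277 (arXiv:2008.09298), §5.4, Lemma 5.20 (arXiv v1 Lemma 121), Claims 5.21–5.22.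
-/

noncomputable section

open Set MeasureTheory Filter
open scoped Topology ENNReal NNReal

namespace Summit.SmoothPoincare4.SmoothPoincare4.Theorems.SubcylindricalRecognition.AncientSphereRigidity

open Literature.Geometry.Riemannian

/-- **Bamler 2023, §5.4, Lemma 5.20 (arXiv v1 Lemma 121) — the limit within a correspondence**, the
registered milestone stub `stub_limitWithin` of the line skeleton (r11): for `H ≥ 0`, a sequence `P`
of `H`-concentrated metric flow pairs over `I₀`, a correspondence `ℭ` between their flows over `I₀`
with complete separable comparison spaces, fully defined over `J`, within which the sequence is
Cauchy uniformly over `J`, there are an `H`-concentrated limit pair `P∞` over `I₀`, fully defined over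
`J`, with measurable exceptional time-set, and a correspondence `ℭ'` between all the flows (indices
`Option ℕ`), fully defined over `J`, within which `P n` `𝔽`-converges to `P∞` uniformly over `J`.
Composition of `exists_limitPair_of_chain` and `limit_fConvergesWithin_of_limitPair`.
[cite: Bamler2023, §5.4, Lemma 5.20 (arXiv v1 Lemma 121)] -/
theorem stub_limitWithin :
    ∀ {I₀ : Set ℝ} {H : ℝ}, 0 ≤ H → ∀ (P : ℕ → MetricFlowPair.{0} I₀),
      (∀ n, (P n).flow.IsHConcentrated H) →
      ∀ (ℭ : MetricFlow.FamilyCorrespondence (fun n ↦ (P n).flow) I₀),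
      (∀ t, CompleteSpace (ℭ.Z t)) → (∀ t, TopologicalSpace.SeparableSpace (ℭ.Z t)) →
      ∀ {J : Set ℝ}, ℭ.FullyDefinedOver J →
      (∀ ε : ENNReal, 0 < ε → ∃ N, ∀ i ≥ N, ∀ j ≥ N, MetricFlowPair.fDistWithinFamily P ℭ i j J ≤ ε) →
      ∃ (Pinf : MetricFlowPair.{0} I₀)
        (ℭ' : MetricFlow.FamilyCorrespondence (fun o : Option ℕ ↦ (o.elim Pinf P).flow) I₀),
        Pinf.flow.IsHConcentrated H ∧ Pinf.FullyDefinedOver J ∧ MeasurableSet (I₀ \ Pinf.I') ∧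
        ℭ'.FullyDefinedOver J ∧ MetricFlowPair.FConvergesWithin P Pinf ℭ' J :=
  fun hH P hP ℭ hZc hZs _ hJ hC ↦
    MetricFlowPair.limit_fConvergesWithin_of_limitPair MetricFlowPair.exists_limitPair_of_chain
      hH P hP ℭ hZc hZs hJ hC

end Summit.SmoothPoincare4.SmoothPoincare4.Theorems.SubcylindricalRecognition.AncientSphereRigidity

end
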